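import Literature.AlgebraicGeometry.Motives.HodgeStructurePushforwardGraphLefschetz
import HarnessLib

/-!
# Milne's formula `Γ_α = (id_A, α)_*(1_A)` for the graph class, and the graded forms of Prop. 5.7 and Cor. 5.5:
# `ū D^p(A) ⊆ D^{p+k−dim A}(B)` for `u ∈ D^k(A × B)`, `φ_* D^p(A) ⊆ D^{p+c}(B)` (`c = dim B − dim A`)

[topic AlgebraicGeometry/Motives]

Layer `Literature/AlgebraicGeometry/Motives`, lane `lit-hodgefound` (Track 2 foundations library; prover seat `lit-hodgefound-p34`,
generation 32, row g32-#7). THEOREMS ONLY (no `def`, no named fact, no instance, no notation; net debt `0`). Sequel of rows g32-#1–#6: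
`gysinSnd` (`q_*`), the dictionary `u ↦ ū = corrMap`, classes `[T] = corrEquiv⁻¹ T`, the Gysin map `φ_* = IsSymplectic.pushforward`
and the graph `Γ_φ := [φ_*]` (Cor. 5.6), the degree bookkeeping (g32-#5) and Prop. 5.7 / Cor. 5.5 (g32-#3, g32-#6).

## Sources, VERBATIM

J. S. Milne, *Lefschetz classes on abelian varieties*, Duke Math. J. **96** (1999) [Milne1999LefschetzClasses], §5 p. 663, proof of
Cor. 5.6: "In fact, `Γ_α = (id_A, α)_*(1_A)`, and `1_A ∈ H⁰(A)` is Lefschetz."  Prop. 5.4: "`φ_* : H^{2s}(A)(s) → H^{2s+2c}(B)(s + c)`";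
Cor. 5.5: "`φ_*` maps Lefschetz classes on `A` to Lefschetz classes on `B`"; p. 664: "`ū : H^*(X) → H^{*+2s−2d}(Y)(s − d)`",
Prop. 5.7: "If `u` is Lefschetz, then `ū` maps `D(A)_k` into `D(B)_k`"; Prop. 5.1 (p. 662): "`D_hom(A)_k` is a graded subalgebra of
`H^{2*}(A)(*)`. In other words, if `α ∈ D_hom(A)_k` and `α = Σ α_r`, `α_r ∈ H^{2r}(A)(r)`, then `α_r ∈ D_hom(A)_k`."

## What is PROVED

* §1 **`IsSymplectic.pushforward_map_coprod_one` — MILNE'S FORMULA `Γ_α = (id_A, α)_*(1_A)`**: for `φ^* = ⋀f : ⋀W₂ → ⋀W₁` and the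
  morphism `(id_A, α) : A → A × B` (`(id_A, α)^* = ⋀(id ⊔ f) : ⋀(W₁ × W₂) → ⋀W₁`, orientation `τ_{ω₁ ⊞ ω₂}` on `⋀(W₁ × W₂)`), the Gysin
  image of `1` IS the class of `φ_*`: `(id, α)_*(1) = corrEquiv⁻¹(φ_*)` — i.e. the tree's `Γ_φ := [φ_*]` of row g32-#6 agrees with Milne's.
  Proof: `(id, α)_* 1 ∈ ⋀^{2g₂}` is central, so `τ_⊞(p^*x ∧ (id,α)_*1 ∧ q^*y) = τ_⊞((id,α)_*1 ∧ p^*x ∧ q^*y) = τ₁((id,α)^*(p^*x ∧ q^*y)) =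
  τ₁(x ∧ φ^*y) = τ₂(φ_* x ∧ y)`, whence `((id,α)_*1)‾ = φ_*` by the two projection formulas. On the carrier:
  **`Polarization.pushforward_prod_map_coprod_one`** (orientation `E_{Q₁ ⊕ Q₂}`).
* §2 **PROP. 5.7, second statement, GRADED: `Polarization.corrMap_apply_mem_map_divisorClasses`** — for a Lefschetz class
  `u ∈ D^k(H₁ ⊕ H₂)` and `x ∈ D^p(H₁)`, `ū x ∈ D^q(H₂)` with `p + k = g₁ + q` (lifting hypothesis as in g32-#3; unconditional
  `…_of_prod_self`).
* §3 **COR. 5.5 GRADED ("`φ_* : H^{2s}(A)(s) → H^{2s+2c}(B)(s+c)`" on `D`): `Polarization.pushforward_apply_mem_map_divisorClasses`** —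
  `φ_* D^p(H₁) ⊆ D^q(H₂)`, `p + g₂ = g₁ + q` (lifting hypothesis; unconditional `…_of_prod_self` for endomorphisms:
  `φ_* D^p(H) ⊆ D^p(H)`), and `Polarization.pushforward_apply_eq_zero_of_lt` (`φ_* = 0` on `⋀^{2p}V₁` when `p + g₂ < g₁`).

TWIN NOTICE (RULING 29 bis): no torus-forms twin imported or restated.

## References

* [Milne1999LefschetzClasses] J. S. Milne, *Lefschetz classes on abelian varieties*, Duke Math. J. 96 (1999), §5 pp. 662–664 (Prop. 5.1,
  Prop. 5.4, Cor. 5.5, Cor. 5.6 and its proof, the dictionary `u ↦ ū`, Prop. 5.7).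
-/

noncomputable section

open scoped TensorProduct

namespace Literature.AlgebraicGeometry.Motives

universe u

namespace ExteriorLefschetz

open Literature.Algebra.Lie ExteriorAlgebra

variable {K : Type*} [Field K] [CharZero K] {W₁ W₂ : Type*} [AddCommGroup W₁] [Module K W₁] [AddCommGroup W₂] [Module K W₂]
  {ω₁ : ExteriorAlgebra K W₁} {g₁ : ℕ} {ω₂ : ExteriorAlgebra K W₂} {g₂ : ℕ}

/-! ## §1 Milne's formula `Γ_α = (id_A, α)_*(1_A)` -/

/-- **MILNE'S FORMULA `Γ_α = (id_A, α)_*(1_A)`** ("In fact, `Γ_α = (id_A, α)_*(1_A)`"): for `φ^* = ⋀f : ⋀W₂ → ⋀W₁`, the Gysin map of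
`(id_A, α)^* = ⋀(id ⊔ f) : ⋀(W₁ × W₂) → ⋀W₁` for the orientation `τ_ω`, `ω = ω₁ ⊞ ω₂`, sends `1` to the class `[φ_*] = corrEquiv⁻¹ φ_*`
realising `φ_*` under the dictionary `u ↦ ū` (so the tree's `Γ_φ := [φ_*]` is Milne's graph class). `(id,α)_* 1 ∈ ⋀^{2g₂}` is central
(`commute_of_mem_exteriorPower_two_mul`), and `τ_ω(p^*x ∧ (id,α)_*1 ∧ q^*y) = τ₁((id,α)^*(p^*x ∧ q^*y)) = τ₁(x ∧ φ^*y) = τ₂(φ_*x ∧ y)`.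
[cite: Milne1999LefschetzClasses, §5 proof of Cor. 5.6 (p. 663)] -/
theorem IsSymplectic.pushforward_map_coprod_one (hω₁ : IsSymplectic ω₁ g₁) (hω₂ : IsSymplectic ω₂ g₂) {ω : ExteriorAlgebra K (W₁ × W₂)}
    (hω : IsSymplectic ω (g₁ + g₂))
    (h : ω = ExteriorAlgebra.map (LinearMap.inl K W₁ W₂) ω₁ + ExteriorAlgebra.map (LinearMap.inr K W₁ W₂) ω₂) (f : W₂ →ₗ[K] W₁) :
    hω.pushforward ω₁ g₁ (ExteriorAlgebra.map (LinearMap.coprod LinearMap.id f)).toLinearMap 1 =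
      hω₁.corrEquiv.symm (hω₂.pushforward ω₁ g₁ (ExteriorAlgebra.map f).toLinearMap) := by
  subst h
  -- `(id, α)_* 1` has degree `2g₂`, hence is central
  have hdeg : hω.pushforward ω₁ g₁ (ExteriorAlgebra.map (LinearMap.coprod LinearMap.id f)).toLinearMap 1 ∈ ⋀[K]^(2 * g₂) (W₁ × W₂) :=
    hω.pushforward_apply_mem (fun _ _ hy ↦ map_mem_exteriorPower _ hy) (i := 0) (by omega)
      (SetLike.one_mem_graded (fun i : ℕ ↦ ⋀[K]^i W₁))
  rw [← hω₁.corrEquiv_symm_corrMap (hω.pushforward ω₁ g₁ (ExteriorAlgebra.map (LinearMap.coprod LinearMap.id f)).toLinearMap 1)]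
  congr 1
  refine hω₂.eq_pushforward_of_forall_trace_mul_eq fun x y ↦ ?_
  rw [corrMap_apply, ← hω₁.trace_mul_map_inr_eq hω₂,
    ← (commute_of_mem_exteriorPower_two_mul hdeg (ExteriorAlgebra.map (LinearMap.inl K W₁ W₂) x)).eq, mul_assoc,
    hω.trace_pushforward_mul, one_mul, AlgHom.toLinearMap_apply, AlgHom.toLinearMap_apply, map_mul, ← AlgHom.comp_apply,
    ← AlgHom.comp_apply, map_comp_map, map_comp_map, LinearMap.coprod_inl, LinearMap.coprod_inr, map_id, AlgHom.id_apply]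

end ExteriorLefschetz

namespace HodgeStructure

open ExteriorLefschetz ExteriorAlgebra

variable {V₁ V₂ : Type u} [AddCommGroup V₁] [Module ℚ V₁] [Module.Finite ℚ V₁] [AddCommGroup V₂] [Module ℚ V₂] [Module.Finite ℚ V₂]
  {n : ℤ} {H₁ : HodgeStructure V₁ n} {H₂ : HodgeStructure V₂ n} (Q₁ : Polarization H₁) (Q₂ : Polarization H₂) (hn : Odd n)
  {g₁ g₂ : ℕ} (hg₁ : Module.finrank ℚ V₁ = 2 * g₁) (hg₂ : Module.finrank ℚ V₂ = 2 * g₂)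

include hn hg₁ hg₂ in
/-- **MILNE'S FORMULA `Γ_α = (id_A, α)_*(1_A)` ON THE CARRIER**: with `f = α^*|H¹ : Hom H₂ H₁`, `(id_A, α)^*|H¹ = id ⊔ f : V₁ ⊕ V₂ → V₁`
(the morphism `pr₁ + f ∘ pr₂` of Hodge structures) and the product orientation `τ_{E_{Q₁ ⊕ Q₂}}` (`E_{Q₁⊕Q₂} = ⋀(inl)E₁ + ⋀(inr)E₂`,
the tree's `coe_lefschetzClass_prod`), `(id_A, α)_*(1_A)` is the graph class `Γ_α = [α_*]` of row g32-#6.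
[cite: Milne1999LefschetzClasses, §5 proof of Cor. 5.6 (p. 663)] -/
theorem Polarization.pushforward_prod_map_coprod_one (f : Hom H₂ H₁) :
    (Q₁.isSymplectic_lefschetzClass_prod Q₂ hn hg₁ hg₂).pushforward (Q₁.lefschetzClass : ExteriorAlgebra ℚ V₁) g₁
        (ExteriorAlgebra.map (LinearMap.coprod LinearMap.id f.toLinearMap)).toLinearMap 1 =
      (Q₁.isSymplectic_lefschetzClass hn hg₁).corrEquiv.symm
        ((Q₂.isSymplectic_lefschetzClass hn hg₂).pushforward (Q₁.lefschetzClass : ExteriorAlgebra ℚ V₁) g₁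
          (ExteriorAlgebra.map f.toLinearMap).toLinearMap) :=
  (Q₁.isSymplectic_lefschetzClass hn hg₁).pushforward_map_coprod_one (Q₂.isSymplectic_lefschetzClass hn hg₂)
    (Q₁.isSymplectic_lefschetzClass_prod Q₂ hn hg₁ hg₂) (Q₁.coe_lefschetzClass_prod Q₂) f.toLinearMap

/-! ## §2 Prop. 5.7, second statement, graded: `ū D^p(A) ⊆ D^{p+k−g₁}(B)` for `u ∈ D^k(A × B)` -/

include hn hg₁ in
/-- **PROP. 5.7, SECOND STATEMENT, GRADED: a Lefschetz class `u ∈ D^k(H₁ ⊕ H₂)` maps `D^p(H₁)` into `D^q(H₂)`, `p + k = g₁ + q`**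
("`ū` maps `D(A)_k` into `D(B)_k`" with "`ū : H^i → H^{i+2s−2d}`", `2s = 2k`, `d = g₁`; and a homogeneous element of `ℚ[B¹]` is in `D`,
Prop. 5.1). Lifting hypothesis `hsurj` ("`L(B)` is a quotient of `L(A × B)`" on `ℂ`-points) as in row g32-#3.
[cite: Milne1999LefschetzClasses, §5 Prop. 5.7 (p. 664), Prop. 5.1 (p. 662)] -/
theorem Polarization.corrMap_apply_mem_map_divisorClasses
    (hsurj : ∀ γ₂ ∈ Q₂.lefschetzGroupBaseChange ℂ, ∃ γ₁ : (ℂ ⊗[ℚ] V₁) ≃ₗ[ℂ] (ℂ ⊗[ℚ] V₁),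
      blockDiag ℂ V₁ V₂ (γ₁, γ₂) ∈ (Q₁.prod Q₂).lefschetzGroupBaseChange ℂ)
    {k : ℕ} {u : ExteriorAlgebra ℚ (V₁ × V₂)} (hu : u ∈ ((H₁.prod H₂).divisorClasses k).map (⋀[ℚ]^(2 * k) (V₁ × V₂)).subtype)
    {p q : ℕ} (hpq : p + k = g₁ + q) {x : ExteriorAlgebra ℚ V₁} (hx : x ∈ (H₁.divisorClasses p).map (⋀[ℚ]^(2 * p) V₁).subtype) :
    corrMap (Q₁.lefschetzClass : ExteriorAlgebra ℚ V₁) g₁ u x ∈ (H₂.divisorClasses q).map (⋀[ℚ]^(2 * q) V₂).subtype := by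
  obtain ⟨u, hu, rfl⟩ := hu
  obtain ⟨x, hx, rfl⟩ := hx
  have hu' : (u : ExteriorAlgebra ℚ (V₁ × V₂)) ∈
      Algebra.adjoin ℚ ((((H₁.prod H₂).exteriorPower 2).hodgeClasses n).map (⋀[ℚ]^2 (V₁ × V₂)).subtype :
        Set (ExteriorAlgebra ℚ (V₁ × V₂))) :=
    ((Q₁.prod Q₂).mem_adjoin_hodgeClasses_two_iff_forall_map_toComplexAlg_eq hn _).2
      (((Q₁.prod Q₂).forall_lefschetzGroupBaseChange_map_toComplexAlg_eq_iff_mem_divisorClasses hn u).2 hu)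
  have hx' : (x : ExteriorAlgebra ℚ V₁) ∈
      Algebra.adjoin ℚ (((H₁.exteriorPower 2).hodgeClasses n).map (⋀[ℚ]^2 V₁).subtype : Set (ExteriorAlgebra ℚ V₁)) :=
    (Q₁.mem_adjoin_hodgeClasses_two_iff_forall_map_toComplexAlg_eq hn _).2
      ((Q₁.forall_lefschetzGroupBaseChange_map_toComplexAlg_eq_iff_mem_divisorClasses hn x).2 hx)
  have h1 := (Q₂.mem_adjoin_hodgeClasses_two_iff_forall_map_toComplexAlg_eq hn _).1
    (Q₁.corrMap_apply_mem_adjoin_hodgeClasses_two Q₂ hn hg₁ hsurj hu' hx')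
  have h2 : corrMap (Q₁.lefschetzClass : ExteriorAlgebra ℚ V₁) g₁ (u : ExteriorAlgebra ℚ (V₁ × V₂)) (x : ExteriorAlgebra ℚ V₁) ∈
      ⋀[ℚ]^(2 * q) V₂ :=
    corrMap_apply_mem_of_mem (by omega) u.2 x.2
  have h : corrMap (Q₁.lefschetzClass : ExteriorAlgebra ℚ V₁) g₁ (u : ExteriorAlgebra ℚ (V₁ × V₂)) (x : ExteriorAlgebra ℚ V₁) ∈
      {y : ExteriorAlgebra ℚ V₂ | y ∈ ⋀[ℚ]^(2 * q) V₂ ∧ ∀ γ ∈ Q₂.lefschetzGroupBaseChange ℂ,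
        ExteriorAlgebra.map (γ : ℂ ⊗[ℚ] V₂ →ₗ[ℂ] ℂ ⊗[ℚ] V₂) (toComplexAlg V₂ y) = toComplexAlg V₂ y} :=
    ⟨h2, h1⟩
  rw [Q₂.setOf_mem_and_forall_lefschetzGroupBaseChange_map_toComplexAlg_eq_eq_map_divisorClasses hn q] at h
  exact h

include hn hg₁ in
/-- **Prop. 5.7, second statement, graded, for `A = B`: `u ∈ D^k(H ⊕ H)`, `x ∈ D^p(H)` ⟹ `ū x ∈ D^{p+k−g}(H)`** (unconditionally;
the diagonal lift `γ ⊕ γ`). [cite: Milne1999LefschetzClasses, §5 Prop. 5.7 (p. 664), Prop. 5.1 (p. 662)] -/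
theorem Polarization.corrMap_apply_mem_map_divisorClasses_of_prod_self {k : ℕ} {u : ExteriorAlgebra ℚ (V₁ × V₁)}
    (hu : u ∈ ((H₁.prod H₁).divisorClasses k).map (⋀[ℚ]^(2 * k) (V₁ × V₁)).subtype) {p q : ℕ} (hpq : p + k = g₁ + q)
    {x : ExteriorAlgebra ℚ V₁} (hx : x ∈ (H₁.divisorClasses p).map (⋀[ℚ]^(2 * p) V₁).subtype) :
    corrMap (Q₁.lefschetzClass : ExteriorAlgebra ℚ V₁) g₁ u x ∈ (H₁.divisorClasses q).map (⋀[ℚ]^(2 * q) V₁).subtype :=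
  Q₁.corrMap_apply_mem_map_divisorClasses Q₁ hn hg₁
    (fun γ hγ ↦ ⟨γ, (Q₁.blockDiag_mem_lefschetzGroupBaseChange_prod_self_iff γ γ).2 ⟨hγ, rfl⟩⟩) hu hpq hx

/-! ## §3 Cor. 5.5, graded: `φ_* D^p(A) ⊆ D^{p+c}(B)`, `c = dim B − dim A` -/

include hn hg₁ in
/-- **COR. 5.5, GRADED: `φ_* D^p(H₁) ⊆ D^q(H₂)` for `p + g₂ = g₁ + q`** ("`φ_* : H^{2s}(A)(s) → H^{2s+2c}(B)(s + c)`" and "`φ_*` maps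
Lefschetz classes on `A` to Lefschetz classes on `B`"; Prop. 5.1 for the graded piece). Lifting hypothesis as in row g32-#3/#6.
[cite: Milne1999LefschetzClasses, §5 Prop. 5.4 and Cor. 5.5 (p. 663), Prop. 5.1 (p. 662)] -/
theorem Polarization.pushforward_apply_mem_map_divisorClasses
    (hsurj : ∀ γ₂ ∈ Q₂.lefschetzGroupBaseChange ℂ, ∃ γ₁ : (ℂ ⊗[ℚ] V₁) ≃ₗ[ℂ] (ℂ ⊗[ℚ] V₁),
      blockDiag ℂ V₁ V₂ (γ₁, γ₂) ∈ (Q₁.prod Q₂).lefschetzGroupBaseChange ℂ)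
    (f : Hom H₂ H₁) {p q : ℕ} (hpq : p + g₂ = g₁ + q) {x : ExteriorAlgebra ℚ V₁}
    (hx : x ∈ (H₁.divisorClasses p).map (⋀[ℚ]^(2 * p) V₁).subtype) :
    (Q₂.isSymplectic_lefschetzClass hn hg₂).pushforward (Q₁.lefschetzClass : ExteriorAlgebra ℚ V₁) g₁
        (ExteriorAlgebra.map f.toLinearMap).toLinearMap x ∈
      (H₂.divisorClasses q).map (⋀[ℚ]^(2 * q) V₂).subtype := by
  obtain ⟨x, hx, rfl⟩ := hx
  have hx' : (x : ExteriorAlgebra ℚ V₁) ∈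
      Algebra.adjoin ℚ (((H₁.exteriorPower 2).hodgeClasses n).map (⋀[ℚ]^2 V₁).subtype : Set (ExteriorAlgebra ℚ V₁)) :=
    (Q₁.mem_adjoin_hodgeClasses_two_iff_forall_map_toComplexAlg_eq hn _).2
      ((Q₁.forall_lefschetzGroupBaseChange_map_toComplexAlg_eq_iff_mem_divisorClasses hn x).2 hx)
  have h1 := (Q₂.mem_adjoin_hodgeClasses_two_iff_forall_map_toComplexAlg_eq hn _).1
    (Q₁.pushforward_apply_mem_adjoin_hodgeClasses_two Q₂ hn hg₁ hg₂ hsurj f hx')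
  have h2 : (Q₂.isSymplectic_lefschetzClass hn hg₂).pushforward (Q₁.lefschetzClass : ExteriorAlgebra ℚ V₁) g₁
      (ExteriorAlgebra.map f.toLinearMap).toLinearMap (x : ExteriorAlgebra ℚ V₁) ∈ ⋀[ℚ]^(2 * q) V₂ :=
    (Q₂.isSymplectic_lefschetzClass hn hg₂).pushforward_apply_mem (fun _ _ hy ↦ map_mem_exteriorPower f.toLinearMap hy)
      (by omega) x.2
  have h : (Q₂.isSymplectic_lefschetzClass hn hg₂).pushforward (Q₁.lefschetzClass : ExteriorAlgebra ℚ V₁) g₁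
      (ExteriorAlgebra.map f.toLinearMap).toLinearMap (x : ExteriorAlgebra ℚ V₁) ∈
      {y : ExteriorAlgebra ℚ V₂ | y ∈ ⋀[ℚ]^(2 * q) V₂ ∧ ∀ γ ∈ Q₂.lefschetzGroupBaseChange ℂ,
        ExteriorAlgebra.map (γ : ℂ ⊗[ℚ] V₂ →ₗ[ℂ] ℂ ⊗[ℚ] V₂) (toComplexAlg V₂ y) = toComplexAlg V₂ y} :=
    ⟨h2, h1⟩
  rw [Q₂.setOf_mem_and_forall_lefschetzGroupBaseChange_map_toComplexAlg_eq_eq_map_divisorClasses hn q] at h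
  exact h

include hn hg₁ in
/-- **Cor. 5.5, graded, for an endomorphism `φ : A → A` (unconditionally): `φ_* D^p(H) ⊆ D^p(H)`.**
[cite: Milne1999LefschetzClasses, §5 Cor. 5.5 (p. 663), Prop. 5.1 (p. 662)] -/
theorem Polarization.pushforward_apply_mem_map_divisorClasses_of_prod_self (f : Hom H₁ H₁) {p : ℕ} {x : ExteriorAlgebra ℚ V₁}
    (hx : x ∈ (H₁.divisorClasses p).map (⋀[ℚ]^(2 * p) V₁).subtype) :
    (Q₁.isSymplectic_lefschetzClass hn hg₁).pushforward (Q₁.lefschetzClass : ExteriorAlgebra ℚ V₁) g₁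
        (ExteriorAlgebra.map f.toLinearMap).toLinearMap x ∈
      (H₁.divisorClasses p).map (⋀[ℚ]^(2 * p) V₁).subtype :=
  Q₁.pushforward_apply_mem_map_divisorClasses Q₁ hn hg₁ hg₁
    (fun γ hγ ↦ ⟨γ, (Q₁.blockDiag_mem_lefschetzGroupBaseChange_prod_self_iff γ γ).2 ⟨hγ, rfl⟩⟩) f (add_comm p g₁) hx

/-- `φ_* = 0` on `⋀^{2p}V₁` when `p + g₂ < g₁` (no target degree; row g32-#6 `pushforward_apply_eq_zero`).
[cite: Milne1999LefschetzClasses, §5 Prop. 5.4 (p. 663)] -/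
theorem Polarization.pushforward_apply_eq_zero_of_lt (f : Hom H₂ H₁) {p : ℕ} (hp : p + g₂ < g₁) {x : ExteriorAlgebra ℚ V₁}
    (hx : x ∈ ⋀[ℚ]^(2 * p) V₁) :
    (Q₂.isSymplectic_lefschetzClass hn hg₂).pushforward (Q₁.lefschetzClass : ExteriorAlgebra ℚ V₁) g₁
        (ExteriorAlgebra.map f.toLinearMap).toLinearMap x = 0 :=
  (Q₂.isSymplectic_lefschetzClass hn hg₂).pushforward_apply_eq_zero (fun _ _ hy ↦ map_mem_exteriorPower f.toLinearMap hy)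
    (by omega) hx

end HodgeStructure

end Literature.AlgebraicGeometry.Motives
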